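import Mathlib
import HarnessLib
import HarnessLib.Audit
import Summits.KontsevichZagierPeriods.Statement
import Literature.NumberTheory.Transcendental.KZCalculusProofs
import HarnessLib.Audit.Status.Attr

/-!
Route: CyclesAsDomains

DORMANT since 2026-08-25T14:33:29Z (reconciler: no traction for 7.8 d (last activity item-evidence-added at 2026-08-17T19:16:55Z); parked, not closed — `ledger route dormant route-KontsevichZagierPeriods-CyclesAsDomains --off` to reacti) — unstaffed, not closed; items shared with open routes are served there. `ledger route dormant <id> --off` reactivates.

# Route CyclesAsDomains — Integrate over the cycle — explicit algebraic cycles are move-chain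
certificates (closed-form Stokes, algebraic primitives off the cycle)

It suffices to show X = ENGINE ∧ COMPLETENESS (card integrate-over-the-cycle). ENGINE
(ZeroBulkStokes, a derived rule of
the H21 calculus): for a closed semialgebraic coefficient system (A_k) on the unit cube — the
pull-back of a CLOSED algebraic
form along a Nash cell of a bounding chain — the zero-bulk Stokes element Σ_k (−1)^k ([top face_k,
A_k] − [bottom face_k, A_k])
lies in KZ.relations: d+1 Newton–Leibniz moves whose primitives are the form's own coefficients,
bulks cancelling; no
antiderivative is ever searched for. An explicit algebraic cycle Z then certifies a period relation
in one of two shapes: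
(a) a bounding semialgebraic chain Γ with ∂Γ = Σ nᵢγᵢ − Z − tubes for a closed form Ω (zero-bulk
Stokes cell by cell), or
(b) [Ω] = c·cl(Z), so Ω = dψ on X∖|Z| with ψ an ALGEBRAIC form (algebraic de Rham theorem) — a
Newton–Leibniz primitive handed
over by the cycle — plus residues along Z. COMPLETENESS (ClosedFormCompleteness, the open core,
conjecture-strength): the
kernel of evaluation is generated by additivity, change of variables, padding and zero-bulk Stokes
elements — the
calculus-internal shadow of 'every vanishing combination of periods is certified by algebraic cycles
on products'
(Kontsevich's formal period conjecture in chain form). The ranked cruxes are the unconditional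
deliverables where proven
Hodge classes exist: Legendre at every algebraic modulus (diagonal of E×E), the generalized Legendre
/ twisted period
relation of every rational signature (diagonal of C×C for cyclic covers), Gauss triplication via the
Aoki–Shioda curve on
the Fermat surface X₉², Gauss quintuplication via Aoki's codimension-2 cycle on the Fermat fourfold
X₂₅⁴.
Lean: `Summit.KontsevichZagierPeriods.KontsevichZagierPeriods.Theses.CyclesAsDomains.ZeroBulkStokes
∧
Summit.KontsevichZagierPeriods.KontsevichZagierPeriods.Theses.CyclesAsDomains.ClosedFormCompleteness`
(the two decls of this route; their one-line bodies over existing declarations are given verbatim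
under ## Cruxes and elaborate in the planner's Sketch.lean, rc 0)

## Assembly
Provable glue (short): from ClosedFormCompleteness, ker eval ≤ closure(1a ∪ 1b ∪ 2 ∪ slabs ∪
zero-bulk); each generator lies
in KZ.relations — rules 1a, 1b, 2 by `KZ.*_subset_relations`, slabs by
`KZ.IntegralRep.of_slab_sub_of_mem_newtonLeibnizRel`,
zero-bulk elements by ZeroBulkStokes (the set in ClosedFormCompleteness repeats its hypotheses
verbatim) — so
`AddSubgroup.closure_le` gives ker eval ≤ relations, i.e.
`Literature.NumberTheory.Transcendental.KZKernelConjecture`, and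
`Summit.KontsevichZagierPeriods.KernelForm.kontsevichZagierPeriods_of_kzKernelConjecture`
(Theorems/KernelFormKernelImpliesStatement.lean,
proved) yields the summit. The ranked cruxes are not antecedents of the implication: they are the
unconditional sector theorems
the engine must deliver first (two-layer plan), exactly as LowDimension's d ≤ 1 and Grothendieck's
ζ(4)/Legendre tests.

Rationale: WHY THIS LINE. A motivic period relation has three ingredients — an algebraic cycle Z on a
ℚ̄-variety (usually a product), a closed
algebraic form Ω, and a homology relation among semialgebraic cycles — and Kontsevich–Zagier's §4.1
Stokes relator
(KontsevichZagier2001; cube form Ayoub2015, HuberMullerStach2017 Ch. 12–13) only ever sees the last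
one at the level of
CLASSES; this line reads the cycle itself as a DOMAIN inside the fixed H21 calculus: cup products
and Poincaré duality are
the diagonal, and every case of the Hodge conjecture someone has proved with an explicit cycle
(Lefschetz (1,1) made
explicit by AokiShioda1983 on Fermat surfaces; Aoki1987 and Shioda1979 on Fermat fourfolds;
Deligne1982HodgeCycles §7 for
the Γ-values they govern) becomes an elementary proof obligation with the cycle as certificate.
Imported areas: Hodge
theory / algebraic cycles (certificates), twisted (co)homology and intersection theory of
hypergeometric integrals
(ChoMatsumoto1995: the bilinear 'twisted Riemann period relations', classical shadow
AndersonEtAl2000 Cor. 3.13(5) and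
Elliott 1904), real semialgebraic geometry (BochnakCosteRoy1998: Nash cells, cubulation). What no
other route does:
NoriTransfer transfers relators abstractly (a map Φ on symbols), Neg and ExpConservative treat the
triplication identity
through Γ (an exponential period) or bet against it, ScissorsTransport removes rule 3 altogether;
here rule 3 is kept but
fed only primitives that come for free (coefficients of closed forms, algebraic primitives certified
by cycles), which is
exactly the regime the catalogued primitive barrier does not touch, and the test bench is
bilinear/cup-product relations
(Legendre at non-CM moduli, signatures 1/3, 1/4, 1/6) that card correspondences-as-multivalued-cov
names as its failure mode.

RANKED CRUXES. #2 LegendreAllModuli (crux) — Legendre's relation EK′ + E′K − KK′ = π/2 at EVERY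
real-algebraic modulus k² = m ∈ (0,1), as ONE 2-dimensional semialgebraic representation on (0,1)²
(integrand e_m(x)κ_(1−m)(y) + e_(1−m)(x)κ_m(y) − κ_m(x)κ_(1−m)(y), κ_m = 1/√((1−x²)(1−mx²)), e_m =
√(1−mx²)/√(1−x²)) KZ-equivalent to [ℝ, 1/(2(1+x²))]; at m = 1/2 the integrand is literally that of
Grothendieck.GpcLegendreLemniscatic (stmt 0280). Card item LegendreViaDiagonal (T1): Y = E×E, Ω =
ω⊠η − η⊠ω, Z = Δ + axes, Γ bounding a×b′ − b′×a − Z − tubes; shared target with cards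
riemann-bilinear-unnesting-triplication-isogeny / unfolding-abelian-integrals-riemann-bilinear
(different chain, same theorem). [deps: ZeroBulkStokes] [difficulty: L] (why it might fail: Γ ⊂ E×E
(or the cut surface) crosses the polar divisor of η⊠ω; the π/2 sits in tube terms at (∞,∞) whose
reduction to [ℝ,1/(2(1+x²))] needs residue moves with semialgebraic primitives on a 3-chain in ℝ⁸ —
never done at a non-CM modulus.) [KontsevichZagier2001, GriffithsHarris1978, Chudnovsky1976,
HuberMullerStach2017, AndersonEtAl2000]
#3 FermatQuintuplication (crux) — the Dirichlet period of the Hodge eigenform ω_a, a =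
(1,6,11,16,21,20) ∈ 𝔅₂₅⁴ — the 5-dimensional representation [open 5-simplex, x₀^(−24/25) x₁^(−19/25)
x₂^(−14/25) x₃^(−9/25) x₄^(−4/25) (1−Σxᵢ)^(−1/5)], value
Γ(1/25)Γ(6/25)Γ(11/25)Γ(16/25)Γ(21/25)Γ(4/5)/Γ(3) = c·π³ with c = 8·5^(3/10)/√(10−2√5) =
2·5^(3/10)/sin(π/5) (Gauss multiplication of order 5 at 1/25 + reflection; Deligne1982HodgeCycles
Thm 7.15) — is KZ-equivalent to the constant c on the product of three closed unit discs in ℝ⁶. a is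
the smallest Hodge sextuple on a Fermat fourfold NOT decomposable under Shioda's inductive structure
(planner's enumeration: none for m ≤ 24; one primitive Galois orbit at m = 25), so its cycle is a
genuinely codimension-2 one (HC(X_m⁴) is known for m ≤ 25, GreenMurreVoisin1994 Ch. V §5.3.2;
explicit cycles Aoki1987). Card item FermatLength3 (T3): certificate shape (b) with iterated
residues along a surface. Also the p = 5 rung of the ladder whose p = 3 rung is
TriplicationAccessible. [deps: ZeroBulkStokes, TriplicationAccessible] [difficulty: XL] (why it
might fail: Needs Aoki1987's explicit cycle for a=(1,6,11,16,21,20) on X₂₅⁴ (paywalled, acq-02211),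
an algebraic 3-form ψ with dψ=ω_a off |Z| (Griffiths reduction on a degree-25 fourfold: size),
iterated residues along a surface; homology torsion may give only N·([r]−[r′]) ∈ relations.)
[Aoki1987, Shioda1979, Deligne1982HodgeCycles, GreenMurreVoisin1994, AokiShioda1983]
#4 ZeroBulkStokes (crux) — ZERO-BULK (CLOSED-FORM) STOKES IS A DERIVED RULE (card item
ClosedFormStokes). On the closed unit cube C ⊂ ℝ^(d+1): given ℚ-semialgebraic coefficients A_k and
divergence terms B_k on C (k ≤ d) with, along coordinate k over every base point of the closed
d-cube, t ↦ A_k continuous on [0,1] and differentiable on (0,1) with derivative B_k (exactly the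
fibrewise regularity of KZ.newtonLeibnizRel), each B_k integrable on C, and CLOSEDNESS Σ_k (−1)^k
B_k = 0 on the open cube, and given face representations ρ₁ k, ρ₀ k on the closed d-cube with
integrands A_k(x with 1, resp. 0, inserted at k): the zero-bulk Stokes element Σ_k (−1)^k ([ρ₁ k] −
[ρ₀ k]) lies in KZ.relations. Proof plan: for each k a coordinate permutation (rule 2, |det| = 1) +
one Newton–Leibniz move with primitive A_k gives [C, B_k] − ([ρ₁ k] − [ρ₀ k]) ∈ relations; signed
integrand additivity sums the bulks to [C, Σ(−1)^k B_k] = [C, 0 a.e.] ∈ relations (null boundary by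
rule 1a, [C°, h] = [C°, 0+0]). The engine of both certificate shapes; the flat case Y = ℝⁿ is card
gauss-manin-rational-certificates B1. [difficulty: M] (why it might fail: Pure bookkeeping
(coordinate permutation as a |det|=1 change of variables, d+1 Newton–Leibniz moves with the given
primitives A_k, signed integrand additivity, [cube, 0] ∈ relations); fails only if a hypothesis is
mistyped — then restate, do not abandon.) [KontsevichZagier2001, Ayoub2015, HuberMullerStach2017,
BochnakCosteRoy1998]
#5 TriplicationAccessible (crux) — the Gauss-triplication pair is KZ-equivalent: [(0,1)²,
x^(−8/9)(1−x)^(−5/9) y^(−4/9)(1−y)^(−2/9)] (value B(1/9,4/9)·B(5/9,7/9) = Γ(1/9)Γ(4/9)Γ(7/9)/Γ(4/3),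
one change of variables away from the Dirichlet period of the eigenform ω_a, a = (1,4,7,6) ∈ 𝔅₉²,
over the real simplex cycle of the Fermat surface X₉²) ~ [disc of radius 2, 3^(7/6)/2] (value
2·3^(7/6)·π). IDENTICAL signature to Neg.TriplicationAccessible (stmt 0312; negation = Neg crux
0311, KZexp form = ExpConservative 0544) — filed to attach this route's NEW LINE: the Hodge class of
a = γ₁ (m = 9, d = 3) is represented by the EXPLICIT Aoki–Shioda curve Z: w³ − (−3)^(1/3)·xyz = 0,
x³ + y³ + z³ = 0 on X₉² (AokiShioda1983 Thm 2, from x³+y³+z³+w³ = (x+y+z)(x+ρy+ρ²z)(x+ρ²y+ρz) +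
(w³+3xyz)), so [ω_a] = c·cl(Σ_g a(g)·g(Z)) and certificate shape (b) applies: ω_a = dψ off |Z| ∪ D
with ψ algebraic, Newton–Leibniz with primitive ψ on the cells of the real cycle, residues of ψ
along Z as π-representations. [deps: ZeroBulkStokes] [difficulty: XL] (why it might fail: The
Aoki–Shioda curve certifies [ω_(1,4,7,6)] = c·cl(Z) on X₉², but the algebraic primitive ψ (dψ = ω_a
off |Z|∪D) must be computed explicitly (degree-9 surface) and its residues along Z turned into
π-reps fibrewise, every intermediate absolutely convergent near |Z|.) [AokiShioda1983,
Deligne1982HodgeCycles, Shioda1979, KontsevichZagier2001]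
#6 GeneralizedLegendre (crux) — the GENERALIZED LEGENDRE RELATION of every rational signature a ∈
(0,1) at every real-algebraic m ∈ (0,1) is KZ-accessible: with κ_m(t) =
t^(−a)(1−t)^(a−1)(1−mt)^(−a), ε_m(t) = t^(−a)(1−t)^(a−1)(1−mt)^(1−a) (so K_a = (sin πa/2)∫κ, E_a =
(sin πa/2)∫ε are (π/2)·₂F₁(a,1−a;1;m), (π/2)·₂F₁(a−1,1−a;1;m)), the 2-dimensional representation
[(0,1)², (1−a)·sin(πa)·(ε_m(x)κ_(1−m)(y) + ε_(1−m)(x)κ_m(y) − κ_m(x)κ_(1−m)(y))] is KZ-equivalent to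
the unit-disc representation [{x²+y² ≤ 1}, 1] (value π; this is KZ.piRep, quantified by domain and
integrand since rev 1); the value identity is E_aK_a′ + E_a′K_a − K_aK_a′ = π sin(πa)/(4(1−a))
(AndersonEtAl2000 Cor. 3.13(5) at c = 1; Elliott 1904; verified numerically by the planner to
1e-15). Card item TwistedPeriodRelation₂F₁ (T2): the rank-2 twisted Riemann period relation of
ChoMatsumoto1995 = cup product H¹_χ × H¹_χ̄ → ℚ(−1) on the cyclic cover C_m: y^N =
t^p(1−t)^(N−p)(1−mt)^p (a = p/N), C_(1−m) ≅ C_m via t ↦ (1−mt)/(1−m); recipe Y = C_m × C_m, Z =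
diagonal + graphs of deck transformations, Ω = ⊠ of eigenforms of the second kind. a = 1/2 is
LegendreAllModuli up to the change of variables t = x². [deps: LegendreAllModuli, ZeroBulkStokes]
[difficulty: XL] (why it might fail: Genus of C_m grows with N; Cho–Matsumoto's regularised (loaded)
twisted cycles and intersection numbers must be replaced by compact semialgebraic chains on C_m×C_m
avoiding the polar divisor; a single rational a with an inaccessible instance kills the ∀ (a=1/2 is
LegendreAllModuli).) [ChoMatsumoto1995, AndersonEtAl2000, KontsevichZagier2001,
Deligne1982HodgeCycles]
#9 ClosedFormCompleteness (support) — OPEN CORE (conjecture-strength; filed as support so that the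
Assembly's dependency is explicit — not to be staffed, no decomposition proposed): every formal
ℤ-combination of integral representations with value 0 lies in the subgroup generated by domain
additivity, integrand additivity, change of variables, padding [σ×[j,j+1], f∘init] − [σ, f]
(KZ.IntegralRep.slab) and the zero-bulk Stokes elements of ZeroBulkStokes. This is the kernel
conjecture presented on the generators the engine produces — the calculus-internal shadow of the
card's CycleFormFPC (certificates (Y, Ω, Γ) cubulate into zero-bulk elements; conversely a zero-bulk
element is a certificate with Y affine space); it implies
Literature.NumberTheory.Transcendental.KZKernelConjecture given ZeroBulkStokes (the Assembly) and
follows from it given ScissorsTransport.NewtonLeibnizElimination (stmt 2668), so it is NOT claimed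
to be easier than the summit. [difficulty: open-problem] [KontsevichZagier2001,
HuberMullerStach2017, Ayoub2015]

TWO-LAYER PLAN. Foreseen glued splits (k ≤ 3, depth 1), filed only when a crux closes or stalls with
a census: LegendreAllModuli ⇐ ResidueMovesDimOne
(∮ R(u)du over a rationally parametrised circle ~ 2π·Re/Im Res as 1-dim moves; LowDimension
territory) → DiagonalChainEtimesE
(the bounding 3-chain and its tube terms at (∞,∞)) → LegendreAllModuli. TriplicationAccessible ⇐
AlgebraicPrimitiveX9 (explicit ψ
with dψ = ω_(1,4,7,6) off |Z| ∪ D, computer algebra) → ResidueAlongAokiShiodaCurve →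
TriplicationAccessible. GeneralizedLegendre ⇐
signatures a ∈ {1/3, 1/4, 1/6} (trigonal/tetragonal covers, Ramanujan's alternative bases) → general
a. FermatQuintuplication ⇐
AokiCycleExplicit (acq-02211) → IteratedResidueCodimTwo → FermatQuintuplication. A general
CertificateTransfer theorem (any
cubulated semialgebraic chain with closed algebraic coefficient data ⇒ boundary reps ∈ relations) is
ZeroBulkStokes + a
face-matching lemma once the notion SemialgebraicCubicalChain exists (definition request).

KILL CRITERIA. An additive invariant ι : FormalRep →+ A vanishing on the four move sets (shape
Neg.NegObstructionShape, stmt 0313) that separates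
the two sides of LegendreAllModuli at one algebraic m, of TriplicationAccessible, or of
FermatQuintuplication refutes that crux AND
the summit: close `refuted:<Decl>` and hand the witness to route Neg. ZeroBulkStokes refuted for a
reason other than a mistyped
hypothesis contradicts the Statement docstring ('Stokes on semialgebraic chains is a combination of
moves') — report to the
operator, restate. A proof of TriplicationAccessible by covering maps / distribution relations
elsewhere (Neg 0312, cards
terasoma-covering-gauss-multiplication, correspondences-as-multivalued-cov) moots rank 5 only; the
line pivots to the cup-product
cruxes 2 and 6, which no finite correspondence induces. Refutation of ClosedFormCompleteness =
refutation of the kernel conjecture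
(all positive routes close).

NOT DECOMPOSED YET. The residue lemma (tube terms ↦ 2π × residue representations, one rung at a
time), cubulation of semialgebraic chains compatible
with a divisor (BochnakCosteRoy1998 §9.2, HuberMullerStach2017 §2.6) and the face-matching lemma,
fundamental-class periods of Z as
π-representations (induction on dimension), the explicit ψ for X₉² and the Aoki cycle for X₂₅⁴, the
choice of eigenforms of the
second kind on cyclic covers — all layer-2 children. Deliberately NOT filed: the Weil-class
prediction (Markman, arXiv:2502.03415:
Hodge–Weil classes on abelian fourfolds are algebraic but no explicit cycle is in print — recorded
as an informal support note),
the T2 corpus beyond rank 2 (Selberg/Lauricella twisted period relations, Goto 2013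
doi:10.1142/s0129167x13500948; KLT /
single-valued 'double copy', Mizera arXiv:1706.08527, Brown–Dupont arXiv:1810.07682),
duplication-type Fermat-surface classes α₁, β₁
(AokiShioda1983 Thms 1, 3; they belong to LowDimension's Legendre-duplication calibration), and any
use of limits ε → 0 (tubes
are kept at fixed algebraic radius).

CHEAPEST FALSIFIER. Numerics cannot kill the cruxes (all four identities are theorems, re-verified
to double precision). Run first the one-page
structural check: in local coordinates (u, v) at (∞,∞) ∈ E×E for m = 1/3, write the tube term of the
bounding chain for
ω⊠η − η⊠ω over a rationally parametrised torus {|u| = ε}×{|v| = ε} and check that after partial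
fractions every non-residue
term has a RATIONAL primitive along the fibre while the residue term is already c·[ℝ, 2/(1+t²)]; if
a primitive of a
non-rational algebraic function is forced, certificate shape (a) fails for Legendre and the crux is
re-planned through shape
(b) (algebraic primitive on E×E minus the diagonal) — a pivot, not a kill. Lookups run: no
rules-level (KZ-moves) proof of
Legendre at a non-CM modulus and no rules-level use of twisted period relations found (lit search
--hybrid ×3, crossref ×4,
2026-08-15; arXiv/OpenAlex/S2 rate-limited, galaxy saturated — refuter please re-run `lit galaxy
search "Legendre relation"
--star all`). The planner's enumeration was the cheapest T3 check: no inductively indecomposable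
Hodge sextuple exists below
m = 25, so FermatQuintuplication is the first honest codimension-2 test.

NUMBERS. Legendre: EK′ + E′K − KK′ = π/2 (checked at m ∈ {0.3, 0.5, 0.81} to 1e-14). Generalized
Legendre (AndersonEtAl2000 Cor. 3.13(5),
c = 1): E_aK_a′ + E_a′K_a − K_aK_a′ = π sin(πa)/(4(1−a)); normalised form (1−a) sin(πa) ∬[…] = π
checked at a ∈ {1/2, 1/3, 1/4,
1/6, 2/7, 1/10}, m ∈ {0.36, 0.9025} to 1e-15. Triplication: B(1/9,4/9)·B(5/9,7/9) = 2·3^(7/6)·π =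
22.63712829483…; Dirichlet form
Γ(1/9)Γ(4/9)Γ(7/9)Γ(2/3) = 4π²·3^(−1/3) = 27.3728059395…. Quintuplication:
Γ(1/25)Γ(6/25)Γ(11/25)Γ(16/25)Γ(21/25)Γ(4/5)/2 =
c·π³ = 170.98260510900…, c = 8·5^(3/10)/√(10−2√5) = 5.514451376151…. Fermat data: NS(X_m²)⊗ℚ is
spanned by lines iff m ≤ 4 or
(m,6) = 1 (AokiShioda1983 §1); Hodge sextuples on X_m⁴ (Σ⟨taᵢ⟩ = 3m ∀ t ∈ (ℤ/m)ˣ): 412 classes at m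
= 21, 1478 at m = 24, 368 at
m = 25 of which exactly 4 primitive indecomposable = one orbit of (1,6,11,16,21,20); HC(X_m⁴) known
for m ≤ 25
(GreenMurreVoisin1994 Ch. V §5.3.2). Chudnovsky1976: trdeg ℚ(K, E, π) = 2 at algebraic moduli, so
Legendre is the only algebraic
relation in its sector. Items at open: 7 (5 cruxes, 1 support, 1 assembly); 2 informal supports + 1
definition request follow.

DEFINITION REQUESTS. (1) notion SemialgebraicCubicalChain (topic
Literature/NumberTheory/Transcendental): finite ℤ-combinations of ℚ-semialgebraic C¹
singular cubes [0,1]^k → ℝ^M, boundary operator, and `KZ.chainRep` = the formal representation Σ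
[cube, coefficient of c^*Ω]
of a semialgebraic k-form — needed to state the general CertificateTransfer theorem (layer 2;
HuberMullerStach2017 Def. 12.1.?,
§2.6). (2) literature want acq-02211 = Aoki1987 (doi:10.2969/jmsj/03930385), for the explicit cycle
behind FermatQuintuplication.
No new fact hypotheses are imported: every crux is stated over KZCalculus and KZCalculusProofs
(slab) only (rev 1, 2026-08-15, cone repair: the KZProduct import — which carried the open Props
PiLocalKernel / PiCancellation and the KZProductIdeal-proved mul_mem_relations_left/right into the
import cone — was dropped by quantifying the unit-disc representation in GeneralizedLegendre instead
of naming KZ.piRep; needs-fact: none).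

Novelty: Searches (2026-08-15): `lit search --hybrid "Legendre relation Riemann bilinear relations cup
product periods second kind"` (8 docs:
HuberWustholz2022, Baker–Wüstholz, Gray 2008, physics handbooks — none at rules level); `lit search
--hybrid "twisted Riemann period
relations intersection form hypergeometric"` (Haraoka 2020 p. 222, AomotoKita 2011 pp. 188–190, 314:
class-level theory);
`lit search --hybrid "Hodge cycles Fermat varieties indecomposable algebraic cycles Aoki Shioda"` (→
book:artin1983-arithmetic-geometry
= AokiShioda1983 READ pp. 5–9; GreenMurreVoisin1994 READ pp. 107–108; Deligne1982 LNM 900 held);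
crossref ×4 (ChoMatsumoto1995,
AndersonEtAl2000 READ pp. 10–12, Aoki1987 paywalled → acq-02211, Goto 2013, Nakamura–Tsuji 2025
unrelated); arXiv / OpenAlex / S2 /
zbMATH: HTTP 429 or 0 hits this session; `lit galaxy search "Hodge cycles on Fermat varieties"
--star all`: service saturated
(> 90 s), not re-run. Card audit (refuter-novelty-9): Ayoub 2014/2015 cube relator and
HuberWustholz2022 p. 13 read.
Nearest prior art found: Ayoub2015 (Conj. 1.1 / Rem. 1.5: the one non-trivial relator ∂f/∂zᵢ − f|₁ +
f|₀ with f ALGEBRAIC on the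
closed polydisc — zero-bulk Stokes is a signed sum of such relators); HuberMullerStach2017 Ch. 12–13
(semialgebraic chains,
naive = cohomological periods, formal period algebra); ChoMatsumoto1995 (twisted period relations as
intersection pairings, at the
level of (co)homology classes with regularised cycles); AokiShioda1983 Thm 2 / Shioda1979  [refs: book:artin1983-arithmetic-geometry, HuberWustholz2022, AokiShioda1983, GreenMurreVoisin1994, Deligne1982, ChoMatsumoto1995, AndersonEtAl2000, Aoki1987, Ayoub2015, HuberMullerStach2017, Shioda1979]

Barriers (technique_class: closed-form-stokes, cycles-as-domains): - technique_class: closed-form-stokes, cycles-as-domains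
- Literature.Barriers.KontsevichZagierPeriods.noSemialgebraicPrimitive_inv_sub_two: evaded
structurally — certificate shape (a) takes no antiderivative at all (the Newton–Leibniz primitives
are the closed form's own coefficients, ZeroBulkStokes), shape (b) uses a primitive ψ that is
ALGEBRAIC because the cycle makes Ω exact on X∖|Z| in algebraic de Rham cohomology (found by linear
algebra / pole reduction, never by integrating out a variable); the barrier's witness 1/(t−2)
concerns eliminating a variable by quadrature, which this line never does.
- Literature.Barriers.KontsevichZagierPeriods.kzConjecture_implies_ellipticPeriods_algIndep:
respected — the cruxes DERIVE the one relation among K, E, K′, E′, π (Chudnovsky1976: trdeg 2) and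
its higher-signature / Fermat analogues from cycles and never assert independence; the strength
barrier (with kzConjecture_implies_oddZetaAlgIndep and kzConjecture_implies_twoPiI_log_algIndep)
bites only through the open core ClosedFormCompleteness, declared conjecture-strength and unstaffed.
- Literature.Barriers.KontsevichZagierPeriods.cressonViuSos_prop_3_2: not engaged — chains are
dissected into Nash cells and moved cell by cell; no global semialgebraic homeomorphism between
domains is asserted.
- Literature.Barriers.KontsevichZagierPeriods.not_complete_of_undecidable: consistent — a
certificate (Z, Ω, Γ) or (Z, Ω, ψ) is finite algebraic data and checking it is a finite move chain;
th

Novelty grade: new-combination — route-review (refuter c310f3d6). ELAB: all 7 typed decls rc0 (W2.lean from ledger signatures; tree file NOT materialised, rev 0 — please re-materialise). Assembly 6592 PROVED (attached). VALUES (decisive: Equivalent ⇒ equal values): all four identities re-verified with the literal typed integrands/c (refuter refuter-rreview-route-AtomisticToContinu-c310f3d6-0, 2026-08-15T14:02:59Z; prior: route-KontsevichZagierPeriods-GaussManinCertificates, route-KontsevichZagierPeriods-UnfoldedStokes, stmt-KontsevichZagierPeriods-3523, stmt-KontsevichZagierPeriods-0312, Ayoub2015, HuberMullerStach2017, ChoMatsumoto1995,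 AndrewsAskeyRoy1999, AokiShioda1983, Aoki1987)

History (route lifecycle, newest last):
- 2026-08-15T16:15:01Z · rev 1: restated GeneralizedLegendre (stmt-KontsevichZagierPeriods-6590) — route-repair (cone + glue, unit rbadge-KontsevichZagierPeriods-CyclesA-d34f3389-g2): (a) RE-ROUTED AROUND the 4 unproved import-cone facts — they all ride in on (planner-rbadge-KontsevichZagierPeriods-CyclesA-d34f3389-g2-0)
- 2026-08-16T02:18:11Z · AUTO-CRUX: 1 conjecture-grade item(s) promoted to crux (ClosedFormCompleteness) — refuter vetting / tiering apply (operator:999:1362873)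
- 2026-08-25T14:33:29Z · DORMANT — reconciler: no traction for 7.8 d (last activity item-evidence-added at 2026-08-17T19:16:55Z); parked, not closed — `ledger route dormant route-KontsevichZagier (operator:999:1459080)

sub-problem: KontsevichZagierPeriods · status: dormant · opened planner-plancard-KontsevichZagierPeriods-Kont-6d432b41-0 2026-08-15T11:48:24Z · rev 2 · ledger route-KontsevichZagierPeriods-CyclesAsDomains
GENERATED by the gate from the ledger (D-0016/17). Provers cite these decls: `theorem foo : Summit.KontsevichZagierPeriods.KontsevichZagierPeriods.Theses.CyclesAsDomains.<Decl> := …` in Summits/KontsevichZagierPeriods/KontsevichZagierPeriods/Theorems/<Name>.lean.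
-/

namespace Summit.KontsevichZagierPeriods.KontsevichZagierPeriods.Theses.CyclesAsDomains

open scoped BigOperators Topology Manifold Classical MeasureTheory ProbabilityTheory Matrix InnerProductSpace ComplexConjugate ContinuousMap
open Filter Set Function TopologicalSpace MeasureTheory

attribute [summit_statement] _root_.KontsevichZagierPeriods

open Literature Periods

/-- item stmt-KontsevichZagierPeriods-6587 · crux · rank 2 · open · by planner
why it might fail: Γ ⊂ E×E (or the cut surface) crosses the polar divisor of η⊠ω; the π/2 sits in tube terms at (∞,∞) whose reduction to [ℝ,1/(2(1+x²))] needs residue moves with semialgebraic primitives on a 3-chain in ℝ⁸ — never done at a non-CM modulus.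
sources: KontsevichZagier2001, GriffithsHarris1978, Chudnovsky1976, HuberMullerStach2017, AndersonEtAl2000
[crux] Legendre's relation EK′ + E′K − KK′ = π/2 at EVERY real-algebraic modulus k² = m ∈ (0,1), as
ONE 2-dimensional semialgebraic representation on (0,1)² (integrand e_m(x)κ_(1−m)(y) +
e_(1−m)(x)κ_m(y) − κ_m(x)κ_(1−m)(y), κ_m = 1/√((1−x²)(1−mx²)), e_m = √(1−mx²)/√(1−x²)) KZ-equivalent
to [ℝ, 1/(2(1+x²))]; at m = 1/2 the integrand is literally that of
Grothendieck.GpcLegendreLemniscatic (stmt 0280). Card item LegendreViaDiagonal (T1): Y = E×E, Ω =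
ω⊠η − η⊠ω, Z = Δ + axes, Γ bounding a×b′ − b′×a − Z − tubes; shared target with cards
riemann-bilinear-unnesting-triplication-isogeny / unfolding-abelian-integrals-riemann-bilinear
(different chain, same theorem). [deps: ZeroBulkStokes] [difficulty: L] -/
@[route_item "route-KontsevichZagierPeriods-CyclesAsDomains"]
def LegendreAllModuli : Prop :=
  ∀ k : ℝ, IsAlgebraic ℚ k → 0 < k → k < 1 → ∀ (r : Literature.NumberTheory.Transcendental.KZ.IntegralRep 2) (r' : Literature.NumberTheory.Transcendental.KZ.IntegralRep 1), r.domain = {x | ∀ i, x i ∈ Set.Ioo (0 : ℝ) 1} → Set.EqOn r.integrand (fun x => Real.sqrt (1 - k ^ 2 * x 0 ^ 2) / Real.sqrt (1 - x 0 ^ 2) / Real.sqrt ((1 - x 1 ^ 2) * (1 - (1 - k ^ 2) * x 1 ^ 2)) + Real.sqrt (1 - (1 - k ^ 2) * x 0 ^ 2) / Real.sqrt (1 - x 0 ^ 2) / Real.sqrt ((1 - x 1 ^ 2) * (1 - k ^ 2 * x 1 ^ 2)) - 1 / Real.sqrt ((1 - x 0 ^ 2) * (1 - k ^ 2 * x 0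 ^ 2)) / Real.sqrt ((1 - x 1 ^ 2) * (1 - (1 - k ^ 2) * x 1 ^ 2))) r.domain → r'.domain = Set.univ → Set.EqOn r'.integrand (fun x => 1 / (2 * (1 + x 0 ^ 2))) r'.domain → Literature.NumberTheory.Transcendental.KZ.Equivalent r r'

/-- item stmt-KontsevichZagierPeriods-6588 · crux · rank 3 · open · by planner
why it might fail: Needs Aoki1987's explicit cycle for a=(1,6,11,16,21,20) on X₂₅⁴ (paywalled, acq-02211), an algebraic 3-form ψ with dψ=ω_a off |Z| (Griffiths reduction on a degree-25 fourfold: size), iterated residues along a surface; homology torsion may give only N·([r]−[r′]) ∈ relations.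
sources: Aoki1987, Shioda1979, Deligne1982HodgeCycles, GreenMurreVoisin1994, AokiShioda1983
[crux] the Dirichlet period of the Hodge eigenform ω_a, a = (1,6,11,16,21,20) ∈ 𝔅₂₅⁴ — the
5-dimensional representation [open 5-simplex, x₀^(−24/25) x₁^(−19/25) x₂^(−14/25) x₃^(−9/25)
x₄^(−4/25) (1−Σxᵢ)^(−1/5)], value Γ(1/25)Γ(6/25)Γ(11/25)Γ(16/25)Γ(21/25)Γ(4/5)/Γ(3) = c·π³ with c =
8·5^(3/10)/√(10−2√5) = 2·5^(3/10)/sin(π/5) (Gauss multiplication of order 5 at 1/25 + reflection;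
Deligne1982HodgeCycles Thm 7.15) — is KZ-equivalent to the constant c on the product of three closed
unit discs in ℝ⁶. a is the smallest Hodge sextuple on a Fermat fourfold NOT decomposable under
Shioda's inductive structure (planner's enumeration: none for m ≤ 24; one primitive Galois orbit at
m = 25), so its cycle is a genuinely codimension-2 one (HC(X_m⁴) is known for m ≤ 25,
GreenMurreVoisin1994 Ch. V §5.3.2; explicit cycles Aoki1987). Card item FermatLength3 (T3):
certificate shape (b) with iterated residues along a surface. Also the p = 5 rung of the ladder
whose p = 3 rung is TriplicationAccessible. [deps: ZeroBulkStokes, TriplicationAccessible]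
[difficulty: XL] -/
@[route_item "route-KontsevichZagierPeriods-CyclesAsDomains"]
def FermatQuintuplication : Prop :=
  ∀ (r : Literature.NumberTheory.Transcendental.KZ.IntegralRep 5) (r' : Literature.NumberTheory.Transcendental.KZ.IntegralRep 6), r.domain = {x | (∀ i, 0 < x i) ∧ ∑ i, x i < 1} → Set.EqOn r.integrand (fun x => (x 0) ^ (-(24:ℝ)/25) * (x 1) ^ (-(19:ℝ)/25) * (x 2) ^ (-(14:ℝ)/25) * (x 3) ^ (-(9:ℝ)/25) * (x 4) ^ (-(4:ℝ)/25) * (1 - ∑ i, x i) ^ (-(1:ℝ)/5)) r.domain → r'.domain = {x | x 0 ^ 2 + x 1 ^ 2 ≤ 1 ∧ x 2 ^ 2 + x 3 ^ 2 ≤ 1 ∧ x 4 ^ 2 + x 5 ^ 2 ≤ 1} → Set.EqOn r'.integrand (fun _ => 8 * (5:ℝ) ^ ((3:ℝ)/10) / Real.sqrt (10 - 2 * Real.sqrt 5)) r'.domain → Literature.NumberTheory.Transcendental.KZ.Equivalent r r'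

/-- item stmt-KontsevichZagierPeriods-6589 · crux · rank 4 · open · by planner
why it might fail: Pure bookkeeping (coordinate permutation as a |det|=1 change of variables, d+1 Newton–Leibniz moves with the given primitives A_k, signed integrand additivity, [cube, 0] ∈ relations); fails only if a hypothesis is mistyped — then restate, do not abandon.
sources: KontsevichZagier2001, Ayoub2015, HuberMullerStach2017, BochnakCosteRoy1998
[crux] ZERO-BULK (CLOSED-FORM) STOKES IS A DERIVED RULE (card item ClosedFormStokes). On the closed
unit cube C ⊂ ℝ^(d+1): given ℚ-semialgebraic coefficients A_k and divergence terms B_k on C (k ≤ d)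
with, along coordinate k over every base point of the closed d-cube, t ↦ A_k continuous on [0,1] and
differentiable on (0,1) with derivative B_k (exactly the fibrewise regularity of
KZ.newtonLeibnizRel), each B_k integrable on C, and CLOSEDNESS Σ_k (−1)^k B_k = 0 on the open cube,
and given face representations ρ₁ k, ρ₀ k on the closed d-cube with integrands A_k(x with 1, resp.
0, inserted at k): the zero-bulk Stokes element Σ_k (−1)^k ([ρ₁ k] − [ρ₀ k]) lies in KZ.relations.
Proof plan: for each k a coordinate permutation (rule 2, |det| = 1) + one Newton–Leibniz move with
primitive A_k gives [C, B_k] − ([ρ₁ k] − [ρ₀ k]) ∈ relations; signed integrand additivity sums the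
bulks to [C, Σ(−1)^k B_k] = [C, 0 a.e.] ∈ relations (null boundary by rule 1a, [C°, h] = [C°, 0+0]).
The engine of both certificate shapes; the flat case Y = ℝⁿ is card
gauss-manin-rational-certificates B1. [difficulty: M] -/
@[route_item "route-KontsevichZagierPeriods-CyclesAsDomains", crux]
def ZeroBulkStokes : Prop :=
  ∀ (d : ℕ) (A B : Fin (d + 1) → (Fin (d + 1) → ℝ) → ℝ) (ρ₁ ρ₀ : Fin (d + 1) → Literature.NumberTheory.Transcendental.KZ.IntegralRep d), (∀ k, Literature.NumberTheory.Transcendental.IsSemialgebraicFunOn ℚ {z : Fin (d + 1) → ℝ | ∀ i, z i ∈ Set.Icc (0:ℝ) 1} (A k)) → (∀ k, Literature.NumberTheory.Transcendental.IsSemialgebraicFunOn ℚ {z : Fin (d + 1) → ℝ | ∀ i, z i ∈ Set.Icc (0:ℝ) 1} (B k)) → (∀ k, MeasureTheory.IntegrableOn (B k) {z : Fin (d + 1) → ℝ | ∀ i, z i ∈ Set.Icc (0:ℝ) 1}) → (∀ k, ∀ x : Fin d → ℝ, (∀ i, x i ∈ Set.Icc (0:ℝ) 1) → ContinuousOn (fun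 t : ℝ => A k (Fin.insertNth k t x)) (Set.Icc 0 1) ∧ ∀ t ∈ Set.Ioo (0:ℝ) 1, HasDerivAt (fun s : ℝ => A k (Fin.insertNth k s x)) (B k (Fin.insertNth k t x)) t) → (∀ z : Fin (d + 1) → ℝ, (∀ i, z i ∈ Set.Ioo (0:ℝ) 1) → ∑ k : Fin (d + 1), (-1 : ℝ) ^ (k : ℕ) * B k z = 0) → (∀ k, (ρ₁ k).domain = {x | ∀ i, x i ∈ Set.Icc (0:ℝ) 1} ∧ (ρ₀ k).domain = {x | ∀ i, x i ∈ Set.Icc (0:ℝ) 1} ∧ Set.EqOn (ρ₁ k).integrand (fun x => A k (Fin.insertNth k 1 x)) {x | ∀ i, x i ∈ Set.Icc (0:ℝ) 1} ∧ Set.EqOn (ρ₀ k).integrand (fun x => A k (Fin.insertNth k 0 x)) {x | ∀ i, x i ∈ Set.Icc (0:ℝ) 1}) → (∑ k : Fin (d + 1), ((-1 : ℤ) ^ (k : ℕ)) • (Literature.NumberTheory.Transcendental.KZ.of (ρ₁ k) - Literature.NumberTheory.Transcendental.KZ.of (ρ₀ k))) ∈ Literature.NumberTheory.Transcendental.KZ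.relations

/-- item stmt-KontsevichZagierPeriods-0312 · crux · rank 5 · open · by planner
why it might fail: The Aoki–Shioda curve certifies [ω_(1,4,7,6)] = c·cl(Z) on X₉², but the algebraic primitive ψ (dψ = ω_a off |Z|∪D) must be computed explicitly (degree-9 surface) and its residues along Z turned into π-reps fibrewise, every intermediate absolutely convergent near |Z|.
sources: AokiShioda1983, Deligne1982HodgeCycles, Shioda1979, KontsevichZagier2001
Positive form of #2. A proof must avoid Γ: candidate strategy = realise the degree-9 Fermat-curve
correspondence behind the identity as semialgebraic changes of variables between (blow-ups of)
(0,1)² pieces plus Newton–Leibniz with algebraic primitives (Rohrlich/Deligne distribution relations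
are induced by the maps x ↦ x³ on Fermat curves — algebraic, finite ⇒ CoV on injectivity cells). If
found, pressure point (b) of route Neg dies at its first instance. [elaborates: yes:
_survey/SketchB.lean; sources: Deligne1982HodgeCycles, KontsevichZagier2001] -/
@[route_item "route-KontsevichZagierPeriods-CyclesAsDomains"]
def TriplicationAccessible : Prop :=
  ∀ (r r' : Literature.NumberTheory.Transcendental.KZ.IntegralRep 2), r.domain = {x | ∀ i, x i ∈ Set.Ioo (0:ℝ) 1} → Set.EqOn r.integrand (fun x => (x 0) ^ (-(8:ℝ)/9) * (1 - x 0) ^ (-(5:ℝ)/9) * (x 1) ^ (-(4:ℝ)/9) * (1 - x 1) ^ (-(2:ℝ)/9)) r.domain → r'.domain = {x | x 0 ^ 2 + x 1 ^ 2 < 4} → Set.EqOn r'.integrand (fun _ => (3:ℝ) ^ ((7:ℝ)/6) / 2) r'.domain → Literature.NumberTheory.Transcendental.KZ.Equivalent r r'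

-- earlier GeneralizedLegendre (stmt-KontsevichZagierPeriods-6590, replaced 2026-08-15T16:15:01Z -> stmt-KontsevichZagierPeriods-10421): retired by None — ∀ (a : ℚ) (m : ℝ), 0 < a → a < 1 → IsAlgebraic ℚ m → 0 < m → m < 1 → ∀ (r : Literature.NumberTheory.Transcendental.KZ.IntegralRep 2), r.domain = {x | ∀ i, x i ∈ Set.Ioo (0:ℝ) 1} → Set.EqOn r.integrand (fun x => (1 - (a:ℝ)) * Real.sin (Real.pi * a) 
/-- item stmt-KontsevichZagierPeriods-10421 · crux · rank 6 · open · by planner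
why it might fail: Genus of C_m grows with N; Cho–Matsumoto's regularised (loaded) twisted cycles and intersection numbers must be replaced by compact semialgebraic chains on C_m×C_m avoiding the polar divisor; a single rational a with an inaccessible instance kills the ∀ (a=1/2 is LegendreAllModuli).
sources: ChoMatsumoto1995, AndersonEtAl2000, KontsevichZagier2001, Deligne1982HodgeCycles, AndrewsAskeyRoy1999
[crux] the GENERALIZED LEGENDRE RELATION of every rational signature a ∈ (0,1) at every
real-algebraic m ∈ (0,1) is KZ-accessible: with κ_m(t) = t^(−a)(1−t)^(a−1)(1−mt)^(−a), ε_m(t) =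
t^(−a)(1−t)^(a−1)(1−mt)^(1−a) (so K_a = (sin πa/2)∫κ, E_a = (sin πa/2)∫ε are (π/2)·₂F₁(a,1−a;1;m),
(π/2)·₂F₁(a−1,1−a;1;m)), the 2-dimensional representation [(0,1)², (1−a)·sin(πa)·(ε_m(x)κ_(1−m)(y) +
ε_(1−m)(x)κ_m(y) − κ_m(x)κ_(1−m)(y))] is KZ-equivalent to every representation [closed unit disc
{x²+y² ≤ 1}, 1] (value π; this is KZ.piRep of KZProduct, quantified here by its domain and integrand
exactly as in TriplicationAccessible / FermatQuintuplication so that the route file imports only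
KZCalculusProofs — cone repair 2026-08-15, statement otherwise unchanged); the value identity is
E_aK_a′ + E_a′K_a − K_aK_a′ = π sin(πa)/(4(1−a)) (AndersonEtAl2000 Cor. 3.13(5) at c = 1 = Elliott's
identity, AndrewsAskeyRoy1999 Thm 3.2.8; verified numerically to 1e-15 by the planner and to 2e-13
by the route reviewer). Card item TwistedPeriodRelation₂F₁ (T2): the rank-2 twisted Riemann period
relation of ChoMatsumoto1995 = cup product H¹_χ × H¹_χ̄ → ℚ(−1) on the cyclic cover C_m: y^N =
t^p(1−t)^(N−p)(1−mt)^p (a = p/ -/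
@[route_item "route-KontsevichZagierPeriods-CyclesAsDomains"]
def GeneralizedLegendre : Prop :=
  ∀ (a : ℚ) (m : ℝ), 0 < a → a < 1 → IsAlgebraic ℚ m → 0 < m → m < 1 → ∀ (r r' : Literature.NumberTheory.Transcendental.KZ.IntegralRep 2), r.domain = {x | ∀ i, x i ∈ Set.Ioo (0:ℝ) 1} → Set.EqOn r.integrand (fun x => (1 - (a:ℝ)) * Real.sin (Real.pi * a) * ((x 0) ^ (-(a:ℝ)) * (1 - x 0) ^ ((a:ℝ) - 1) * (1 - m * x 0) ^ (1 - (a:ℝ)) * ((x 1) ^ (-(a:ℝ)) * (1 - x 1) ^ ((a:ℝ) - 1) * (1 - (1 - m) * x 1) ^ (-(a:ℝ))) + (x 0) ^ (-(a:ℝ)) * (1 - x 0) ^ ((a:ℝ) - 1) * (1 - (1 - m) * x 0) ^ (1 - (a:ℝ)) * ((x 1) ^ (-(a:ℝ)) * (1 - x 1) ^ ((a:ℝ) - 1) * (1 - m * x 1) ^ (-(a:ℝ))) - (x 0) ^ (-(a:ℝ)) * (1 - x 0) ^ ((a:ℝ) - 1) * (1 - m * x 0) ^ (-(a:ℝ))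 * ((x 1) ^ (-(a:ℝ)) * (1 - x 1) ^ ((a:ℝ) - 1) * (1 - (1 - m) * x 1) ^ (-(a:ℝ))))) r.domain → r'.domain = {x | x 0 ^ 2 + x 1 ^ 2 ≤ 1} → Set.EqOn r'.integrand (fun _ => (1:ℝ)) r'.domain → Literature.NumberTheory.Transcendental.KZ.Equivalent r r'

/-- item stmt-KontsevichZagierPeriods-6591 · crux (kind.auto-crux: conjecture-grade) · rank 9 · open · by planner
why it might fail: auto-crux — conjecture-grade statement (docstring avows it ('conjecture')); it is open, so it may simply be false
sources: KontsevichZagier2001, HuberMullerStach2017, Ayoub2015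
[support] OPEN CORE (conjecture-strength; filed as support so that the Assembly's dependency is
explicit — not to be staffed, no decomposition proposed): every formal ℤ-combination of integral
representations with value 0 lies in the subgroup generated by domain additivity, integrand
additivity, change of variables, padding [σ×[j,j+1], f∘init] − [σ, f] (KZ.IntegralRep.slab) and the
zero-bulk Stokes elements of ZeroBulkStokes. This is the kernel conjecture presented on the
generators the engine produces — the calculus-internal shadow of the card's CycleFormFPC
(certificates (Y, Ω, Γ) cubulate into zero-bulk elements; conversely a zero-bulk element is a
certificate with Y affine space); it implies
Literature.NumberTheory.Transcendental.KZKernelConjecture given ZeroBulkStokes (the Assembly) and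
follows from it given ScissorsTransport.NewtonLeibnizElimination (stmt 2668), so it is NOT claimed
to be easier than the summit. [difficulty: open-problem] -/
@[route_item "route-KontsevichZagierPeriods-CyclesAsDomains", crux]
def ClosedFormCompleteness : Prop :=
  ∀ c : Literature.NumberTheory.Transcendental.KZ.FormalRep, Literature.NumberTheory.Transcendental.KZ.eval c = 0 → c ∈ AddSubgroup.closure (Literature.NumberTheory.Transcendental.KZ.domainAddRel ∪ Literature.NumberTheory.Transcendental.KZ.integrandAddRel ∪ Literature.NumberTheory.Transcendental.KZ.changeOfVariablesRel ∪ {c | ∃ (n : ℕ) (r : Literature.NumberTheory.Transcendental.KZ.IntegralRep n) (j : ℕ), c = Literature.NumberTheory.Transcendental.KZ.of (r.slab j) - Literature.NumberTheory.Transcendental.KZ.of r} ∪ {c | ∃ (d : ℕ) (A : Fin (d + 1) → (Fin (d + 1) → ℝ) → ℝ) (B : Fin (d + 1) → (Fin (d + 1) → ℝ) → ℝ) (ρ₁ ρ₀ : Fin (d + 1) → Literature.NumberTheory.Transcendental.KZ.IntegralRep d), (∀ k, Literature.NumberTheory.Transcendental.IsSemialgebraicFunOn ℚ {z : Fin (d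 + 1) → ℝ | ∀ i, z i ∈ Set.Icc (0:ℝ) 1} (A k)) ∧ (∀ k, Literature.NumberTheory.Transcendental.IsSemialgebraicFunOn ℚ {z : Fin (d + 1) → ℝ | ∀ i, z i ∈ Set.Icc (0:ℝ) 1} (B k)) ∧ (∀ k, MeasureTheory.IntegrableOn (B k) {z : Fin (d + 1) → ℝ | ∀ i, z i ∈ Set.Icc (0:ℝ) 1}) ∧ (∀ k, ∀ x : Fin d → ℝ, (∀ i, x i ∈ Set.Icc (0:ℝ) 1) → ContinuousOn (fun t : ℝ => A k (Fin.insertNth k t x)) (Set.Icc 0 1) ∧ ∀ t ∈ Set.Ioo (0:ℝ) 1, HasDerivAt (fun s : ℝ => A k (Fin.insertNth k s x)) (B k (Fin.insertNth k t x)) t) ∧ (∀ z : Fin (d + 1) → ℝ, (∀ i, z i ∈ Set.Ioo (0:ℝ) 1) → ∑ k : Fin (d + 1), (-1 : ℝ) ^ (k : ℕ) * B k z = 0) ∧ (∀ k, (ρ₁ k).domain = {x | ∀ i, x i ∈ Set.Icc (0:ℝ) 1} ∧ (ρ₀ k).domain = {x | ∀ i, x i ∈ Set.Icc (0:ℝ)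 1} ∧ Set.EqOn (ρ₁ k).integrand (fun x => A k (Fin.insertNth k 1 x)) {x | ∀ i, x i ∈ Set.Icc (0:ℝ) 1} ∧ Set.EqOn (ρ₀ k).integrand (fun x => A k (Fin.insertNth k 0 x)) {x | ∀ i, x i ∈ Set.Icc (0:ℝ) 1}) ∧ c = ∑ k : Fin (d + 1), ((-1 : ℤ) ^ (k : ℕ)) • (Literature.NumberTheory.Transcendental.KZ.of (ρ₁ k) - Literature.NumberTheory.Transcendental.KZ.of (ρ₀ k))})

-- item stmt-KontsevichZagierPeriods-7309 · support · rank 9 · open · by planner — informal only, no Lean statement yet: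
--   [support] WEIL-CLASS PREDICTION (card item WeilClassPrediction; recorded, not staffed). Markman
--   (arXiv:2502.03415, pp. 2–3: Hodge–Weil classes on abelian fourfolds of Weil type with K imaginary
--   quadratic are algebraic, whence the Hodge conjecture for abelian fourfolds) moves Shimura's monomial
--   period relations for CM abelian fourfolds of Weil type — proved analytically by Shimura and
--   motivically by Deligne/Blasius through ABSOLUTE Hodge classes — from 'absolute Hodge only' to
--   'cycle-certified': by the engine of this route (certificate shape (b): [Ω] = c·cl(Z) ⇒ Ω = dψ off
--   |Z| with ψ algebraic

-- item stmt-KontsevichZagierPeriods-7311 · support · rank 9 · open · by planner — informal only, no Lean statement yet: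
--   [support] CERTIFICATE TRANSFER (the general engine theorem; layer-2 parent of nothing yet, awaiting
--   the definition SemialgebraicCubicalChain). For a finite ℤ-combination Γ = Σ n_j c_j of
--   ℚ-semialgebraic C¹ singular (d+1)-cubes c_j : [0,1]^(d+1) → ℝ^M and a system of ℚ-semialgebraic
--   d-form coefficient data pulled back along each c_j that is CLOSED on every cube (hypotheses of
--   ZeroBulkStokes cube by cube) and MATCHES on internal faces (the two face representations induced by
--   adjacent cubes differ by an orientation-reversing affine change of variables of the d-cube), the
--   formal sum of the EXTERNA

/-- item stmt-KontsevichZagierPeriods-6592 · assembly · rank 1 · closed · proved by Summit.KontsevichZagierPeriods.CyclesAsDomains.assembly_proof @ 71d4d39983ab (prover) · by planner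
sources: KontsevichZagier2001, HuberMullerStach2017
[assembly] ZeroBulkStokes → ClosedFormCompleteness → KontsevichZagierPeriods (closure_le over the
five generator sets, then the proved kernel-implies-statement theorem). -/
@[route_item "route-KontsevichZagierPeriods-CyclesAsDomains"]
def Assembly : Prop :=
  ZeroBulkStokes → ClosedFormCompleteness → KontsevichZagierPeriods

/-! D-0027 §2.1 — DECIDING THEOREM (planner-authored via `route open/edit --closes-file`; by planner-rbadge-KontsevichZagierPeriods-CyclesA-d34f3389-g2-0 2026-08-15T16:15:01Z):
its hypotheses are this route's items and its conclusion the sub-problem Statement (glue_lint), and it elaborates with this file. -/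

/-- DECIDING THEOREM (D-0027 §2.1) of route CyclesAsDomains. From `ClosedFormCompleteness`, every
formal combination with value `0` lies in the closure of the five generator sets; each generator
is a relation — moves (1a), (1b), (2) by `KZ.*_subset_relations`, slabs by one Newton–Leibniz move
(`KZ.IntegralRep.of_slab_sub_of_mem_newtonLeibnizRel`), zero-bulk Stokes elements by
`ZeroBulkStokes` — so `AddSubgroup.closure_le` gives `ker eval ≤ relations`
(`KZKernelConjecture`), and the kernel form implies the statement (`r.value = r'.value` gives
`eval ([r] - [r']) = 0`, and `KZ.Equivalent r r'` is `[r] - [r'] ∈ relations`). -/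
@[closes "route-KontsevichZagierPeriods-CyclesAsDomains"] theorem closes (hZ : ZeroBulkStokes) (hC : ClosedFormCompleteness) : _root_.KontsevichZagierPeriods := by
  have hK : Literature.NumberTheory.Transcendental.KZKernelConjecture := by
    intro c hc
    have hmem := hC c hc
    refine (AddSubgroup.closure_le _).mpr ?_ hmem
    rintro x ((((hx | hx) | hx) | hx) | hx)
    · exact Literature.NumberTheory.Transcendental.KZ.domainAddRel_subset_relations hx
    · exact Literature.NumberTheory.Transcendental.KZ.integrandAddRel_subset_relations hx
    · exact Literature.NumberTheory.Transcendental.KZ.changeOfVariablesRel_subset_relations hx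
    · obtain ⟨n, r, j, rfl⟩ := hx
      exact Literature.NumberTheory.Transcendental.KZ.newtonLeibnizRel_subset_relations
        (Literature.NumberTheory.Transcendental.KZ.IntegralRep.of_slab_sub_of_mem_newtonLeibnizRel r j)
    · obtain ⟨d, A, B, ρ₁, ρ₀, hA, hB, hI, hR, h0, hF, rfl⟩ := hx
      exact hZ d A B ρ₁ ρ₀ hA hB hI hR h0 hF
  intro n m r r' _ _ hv
  apply hK
  simp [Literature.NumberTheory.Transcendental.KZ.eval_of, hv]

end Summit.KontsevichZagierPeriods.KontsevichZagierPeriods.Theses.CyclesAsDomains
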